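import Mathlib

/-!
# Hodge-locus census — degree bookkeeping of the Cayley–Bacharach step in THEOREM SPEC-3 (ENGINE B, gen 32, record §9f)

Certified instances and evidence bearing on the general Hodge conjecture; no claim.

THEOREM SPEC-3 (paper proof in the record, §9f): for a complete intersection `J` of `k` forms of
degree `e+1` in `k` variables (`k ≥ 3`, `e ≥ 3`) and `δ` of degree `e`, the kernel of
multiplication by `δ` on quadrics has dimension `0`, `1` or `k`.  Step 4 of the proof applies the
Cayley–Bacharach theorem for the partial complete intersection `Z = V(G₁,…,G_{k-1}) ⊂ ℙ^{k-1}`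
(Davis–Geramita–Orecchia): with `m = k-1` hypersurfaces of degree `e+1` the parameter is
`s = Σ dᵢ - m - 1`, and a form of degree `a = e+1` through the residual of `W = Z ∩ Λ` lies in `I_Z`
as soon as `W` imposes independent conditions in degree `D = s - a`.  Step 5 needs `D ≥ (k-3)·e`
(the degree from which a complete intersection of type `(e+1)^{k-3}` in `Λ ≅ ℙ^{k-3}` imposes
independent conditions).  This file kernel-checks exactly that bookkeeping (over `ℤ`, so that no
truncated subtraction intervenes): `s = (k-1)e - 1`, `D = (k-2)e - 2`, `(k-3)e ≤ D ⇔ 2 ≤ e`-direction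
used, `1 ≤ D` for `k ≥ 3, e ≥ 3`, and the classical plane case `k = 3`: `s = 2(e+1) - 3`.
Nothing here formalises the commutative algebra; it pins the integers the paper proof uses.
-/

namespace Summit.HodgeConjecture.HodgeConjecture.HodgeLocus.Census.Spec3

/-- Cayley–Bacharach parameter `s = Σ dᵢ - m - 1` for `m = k-1` hypersurfaces of degree `e+1`. -/
def cbS (k e : ℤ) : ℤ := (k - 1) * (e + 1) - (k - 1) - 1

/-- The degree in which the residual scheme must impose independent conditions: `D = s - (e+1)`. -/
def cbD (k e : ℤ) : ℤ := cbS k e - (e + 1)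

/-- `s = (k-1)e - 1`. -/
theorem cbS_eq (k e : ℤ) : cbS k e = (k - 1) * e - 1 := by
  unfold cbS; ring

/-- `D = (k-2)e - 2`. -/
theorem cbD_eq (k e : ℤ) : cbD k e = (k - 2) * e - 2 := by
  unfold cbD cbS; ring

/-- Step 5 of the record's proof: the slack `D - (k-3)e = e - 2` is non-negative for `e ≥ 2`. -/
theorem cbD_sub_reg (k e : ℤ) : cbD k e - (k - 3) * e = e - 2 := by
  rw [cbD_eq]; ring

/-- `(k-3)e ≤ D` whenever `e ≥ 2` (Step 5). -/
theorem reg_le_cbD {k e : ℤ} (he : 2 ≤ e) : (k - 3) * e ≤ cbD k e := by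
  have h := cbD_sub_reg k e
  linarith

/-- `D ≥ 1` in the range of the theorem (`k ≥ 3`, `e ≥ 3`). -/
theorem one_le_cbD {k e : ℤ} (hk : 3 ≤ k) (he : 3 ≤ e) : 1 ≤ cbD k e := by
  rw [cbD_eq]
  have h1 : 0 ≤ k - 3 := by linarith
  have h2 : 0 ≤ e := by linarith
  nlinarith [mul_nonneg h1 h2]

/-- The plane case `k = 3`: `s = d₁ + d₂ - 3` with `d₁ = d₂ = e+1` — the classical Cayley–Bacharach
degree for two plane curves. -/
theorem cbS_plane (e : ℤ) : cbS 3 e = 2 * (e + 1) - 3 := by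
  unfold cbS; ring

/-- In the plane case the form of degree `e+1` is within the classical range `≤ s` iff `e ≥ 2`
(slack `s - (e+1) = e - 2`). -/
theorem plane_slack (e : ℤ) : cbS 3 e - (e + 1) = e - 2 := by
  unfold cbS; ring

end Summit.HodgeConjecture.HodgeConjecture.HodgeLocus.Census.Spec3
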